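import Literature.MathematicalPhysics.QuantumFieldTheory.Balaban1983to89.B9Thm37GlueTorusCov

/-!
# Literature: Bałaban's propagators for lattice gauge theories [B9] — a comb Poincaré inequality and the
COERCIVITY of Δ_U + a·Q_UᵀQ_U, uniform in the transport and in the volume (pv21 node HOM-PU-COVPOINC; MODEL)

Sources (bib keys):
* [B9] = `Balaban1985BackgroundPropagators` — T. Bałaban, *Propagators for lattice gauge theories in a background
  field*, Commun. Math. Phys. 99 (1985) 389–434.
* [B7] = `Balaban1985Averaging` — T. Bałaban, *Averaging operations for lattice gauge theories*, Commun. Math.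
  Phys. 98 (1985) 17–51 (context only: print's reference [5] for the contours; nothing of it is quoted or used).
* [B6] = `Balaban1984PropagatorsII` — T. Bałaban, *Propagators and renormalization transformations for lattice
  gauge theories. II*, Commun. Math. Phys. 96 (1984) 223–250 (context only: print's own telescoping-along-
  coordinate-paths Poincaré inequality (2.123) p. 244 for BOND variables, certified in `B6TreeGaugePoincare`; the
  site-variable comb telescoping below is its elementary analogue; nothing of [B6] is quoted or used).

THE PRINTED LOCI.  NO new «» span in this file.  Context, all certified in the headers of modules this file
imports: [B9] (3.18)–(3.19) p. 393 (the one-step covariant averaging operators Q′(V), Q′_j(U);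
`B9Thm37GlueTorusCov`), (3.3) pp. 390–391 (∇_U; `B9Thm37Glue`), (3.23)–(3.24) p. 394 (Δ′_a = Δ_U + Q′\*aQ′;
`B9Thm37Glue`), p. 395 *"Assuming some regularity of the configuration U it can be easily shown that the operator
Δ′_a is positive. This implies positivity of the operators G′, Q′G′²Q′\*, hence the existence of the operator R."*
(`B9Thm37Glue` v6 addendum, `B9Thm37GlueTorusInv`), (3.42) p. 397 (`B9Thm37Glue`).

THE POINT.  `B9Thm37GlueTorusCov.posDef_covLapCov` gives STRICT positivity of the one-step model
Δ_U + a·Q_UᵀQ_U (D\*D + a·Q_UᵀQ_U with the covariant block mean Q_U of an abstract comb) for EVERY isometric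
transport, hence invertibility and a genuine two-sided `Ring.inverse` — but no lower bound.  Any (3.42)-shaped
decay estimate for that inverse on the BLOCK scale (the lineage's next step) needs a coercivity constant that sees
neither the transport U nor the volume.  This file proves one, by a POINCARÉ INEQUALITY ALONG THE COMB:

* §1 `pathSum K u x` = Σ u(b) over the parent bonds of the comb path from the base point to x (depth recursion);
  `pathSum_le_blockSum`: for u ≥ 0 it is bounded by the sum of u over ALL parent bonds of the block of x (the path
  points have pairwise distinct depths, the parent bond map is injective).
* §2 `dev K Rm f x i` = ((tr x)f(x))_i − f(base, i), the deviation of the transported field from its base-point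
  value; ONE STEP (`dev_step`): dev(x) − dev(parent x) = (tr parent)·c(b)⁻¹(∇_U f)(b), b = the parent bond, and the
  transport is an isometry (`sum_sq_tr_apply`, from `Comb.tr_orth`); INDUCTION with the built-in Cauchy–Schwarz
  step m|α+β|² ≤ (m+1)|α|² + m(m+1)|β|² (`dev_sq_le`): |dev(x)|² ≤ depth(x)·pathSum(c⁻²|∇_U f|²)(x).
* §3 the block identity `sum_sq_le_sq_sum_div_add` (Σ_s h² ≤ (Σ_s h)²/|s| + Σ_s (h − v)² for every v) and the
  assembly **`norm_sq_le`**: for isometric bond matrices (hRm), |c(b)| ≥ c_min > 0, |w(β)| ≥ w_min > 0,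
  depth ≤ D, blocks of at most n sites,
      Σ_p f(p)² ≤ w_min⁻²·Σ_q (Q_U f)(q)² + D·n·c_min⁻²·Σ_b ((∇_U f)(b))²
  for EVERY field f and EVERY such transport; hence **`coercive_covLapCov`**:
      σ·Σ_p f(p)² ≤ Σ_p f(p)((Δ_U + a·Q_UᵀQ_U)f)(p),   σ = (1/(a·w_min²) + D·n/c_min²)⁻¹ > 0,
  and the ℓ²-BOUND OF THE INVERSE **`inverse_sq_le`**: Σ_p ((Δ_U + a·Q_UᵀQ_U)⁻¹g)(p)² ≤ σ⁻²·Σ_p g(p)².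
* §4 the torus: `tdepth_le` (depth ≤ d(M₀ − 1)) and `card_block_le` (a block has at most M₀^d sites, by the
  injection x ↦ (x_μ mod M₀)_μ), whence **`coercive_covLapCov_torus`** / **`inverse_sq_le_torus`** with
  σ = σ(d, M₀, c_min, w_min, a) — the SAME constant for every torus `UT N` with M₀ ∣ N_i and every isometric
  transport: uniform in the volume and in U.

NOT ASSERTED.  Anything printed: print's Δ′_a is multiscale (the j-fold operators Q′_j(U) over L^j-blocks with
the scale-dependent weights of (3.16)/(3.24)); its positivity *"assuming some regularity of U"* (p. 395)
and the bounds behind (3.42) are print's claims about print's operator and are neither formalised nor approximated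
here.  In the one-step MODEL no regularity of U is needed because a one-step comb mean reproduces every covariantly
constant field exactly; the price is the constant: the comb Poincaré constant D·n = d(M₀−1)M₀^d is cruder than the
O(M₀²) of a genuine cube Poincaré inequality (the scalar U ≡ 1 analogue with the sharp scaling is
`Beta.CoordCubePoincare`, not used).  No decay of the inverse is claimed — only its ℓ² bound σ⁻¹.

This module is additive: it imports `B9Thm37GlueTorusCov` only and modifies nothing.  Every declaration is tagged
`[folklore]` (finite-dimensional linear algebra / counting) or cites the printed locus it MODELS.  Value = kernel
certificate for the lineage's one-scale model, NOT summit progress; NOT continuum, NOT Clay.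
-/

namespace Literature.MathematicalPhysics.QuantumFieldTheory.Balaban1983to89.B9Thm37GlueTorusCovPoinc

open Finset B9Thm37Sum B9Thm37Glue B9Thm37GlueTorusInv B9Thm37GlueTorusCov
open B5TorusCover (UT Ctr)

noncomputable section

/-! ## §1  Path sums along the comb -/

section PathSum

variable {St Bd B : Type} {src tgt : Bd → St} (K : Comb src tgt B)

/-- Path sum by fuel recursion (MODEL bookkeeping; `pathSum` takes fuel = depth). [folklore] -/
def pathSumAux (u : Bd → ℝ) : ℕ → St → ℝ
  | 0 => fun _ => 0
  | n + 1 => fun x => if K.depth x = 0 then 0 else pathSumAux u n (K.parent x) + u (K.pbond x)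

/-- **The path sum** Σ_k u(b_k) over the parent bonds b_k of the comb path base = x₀ → x₁ → ⋯ → x_m = x.
[folklore] -/
def pathSum (u : Bd → ℝ) (x : St) : ℝ := pathSumAux K u (K.depth x) x

/-- At a base point the path sum is empty. [folklore] -/
theorem pathSum_of_depth_eq_zero (u : Bd → ℝ) {x : St} (hx : K.depth x = 0) : pathSum K u x = 0 := by
  unfold pathSum
  rw [hx]
  rfl

/-- The recursion: pathSum x = pathSum (parent x) + u (pbond x) at positive depth. [folklore] -/
theorem pathSum_of_depth_ne_zero (u : Bd → ℝ) {x : St} (hx : K.depth x ≠ 0) :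
    pathSum K u x = pathSum K u (K.parent x) + u (K.pbond x) := by
  obtain ⟨n, hn⟩ := Nat.exists_eq_succ_of_ne_zero hx
  have hp : K.depth (K.parent x) = n := by
    have := K.depth_parent x hx
    omega
  unfold pathSum
  rw [hn, hp]
  show (if K.depth x = 0 then (0 : ℝ) else pathSumAux K u n (K.parent x) + u (K.pbond x)) = _
  rw [if_neg hx]

/-- A path sum of non-negative terms is non-negative. [folklore] -/
theorem pathSum_nonneg {u : Bd → ℝ} (hu : ∀ b, 0 ≤ u b) : ∀ x, 0 ≤ pathSum K u x := by
  suffices h : ∀ n x, K.depth x = n → 0 ≤ pathSum K u x from fun x => h _ x rfl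
  intro n
  induction n with
  | zero => intro x hx; rw [pathSum_of_depth_eq_zero K u hx]
  | succ n ih =>
      intro x hx
      have hx0 : K.depth x ≠ 0 := by omega
      have hp : K.depth (K.parent x) = n := by
        have := K.depth_parent x hx0
        omega
      rw [pathSum_of_depth_ne_zero K u hx0]
      exact add_nonneg (ih _ hp) (hu _)

/-- A path sum is monotone in its non-negative integrand. [folklore] -/
theorem pathSum_mono {u v : Bd → ℝ} (huv : ∀ b, u b ≤ v b) : ∀ x, pathSum K u x ≤ pathSum K v x := by
  suffices h : ∀ n x, K.depth x = n → pathSum K u x ≤ pathSum K v x from fun x => h _ x rfl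
  intro n
  induction n with
  | zero => intro x hx; rw [pathSum_of_depth_eq_zero K u hx, pathSum_of_depth_eq_zero K v hx]
  | succ n ih =>
      intro x hx
      have hx0 : K.depth x ≠ 0 := by omega
      have hp : K.depth (K.parent x) = n := by
        have := K.depth_parent x hx0
        omega
      rw [pathSum_of_depth_ne_zero K u hx0, pathSum_of_depth_ne_zero K v hx0]
      exact add_le_add (ih _ hp) (huv _)

variable [Fintype St] [DecidableEq St] [DecidableEq B]

/-- The parent bonds of the block of x, at depths in (0, m]. [folklore] -/
theorem pathSum_le_layerSum {u : Bd → ℝ} (hu : ∀ b, 0 ≤ u b) : ∀ x,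
    pathSum K u x ≤ ∑ y ∈ univ.filter (fun y => K.blk y = K.blk x ∧ K.depth y ≠ 0 ∧ K.depth y ≤ K.depth x),
      u (K.pbond y) := by
  suffices h : ∀ n x, K.depth x = n → pathSum K u x ≤
      ∑ y ∈ univ.filter (fun y => K.blk y = K.blk x ∧ K.depth y ≠ 0 ∧ K.depth y ≤ K.depth x), u (K.pbond y) from
    fun x => h _ x rfl
  intro n
  induction n with
  | zero =>
      intro x hx
      rw [pathSum_of_depth_eq_zero K u hx]
      exact Finset.sum_nonneg fun y _ => hu _
  | succ n ih =>
      intro x hx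
      have hx0 : K.depth x ≠ 0 := by omega
      have hp : K.depth (K.parent x) = n := by
        have := K.depth_parent x hx0
        omega
      rw [pathSum_of_depth_ne_zero K u hx0]
      have hblk : K.blk (K.parent x) = K.blk x := K.blk_parent x hx0
      set A := univ.filter (fun y => K.blk y = K.blk (K.parent x) ∧ K.depth y ≠ 0 ∧ K.depth y ≤ K.depth (K.parent x))
        with hA
      set Bset := univ.filter (fun y => K.blk y = K.blk x ∧ K.depth y ≠ 0 ∧ K.depth y ≤ K.depth x) with hB
      have hxA : x ∉ A := by
        rw [hA, mem_filter]
        intro h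
        have := h.2.2.2
        omega
      have hsub : insert x A ⊆ Bset := by
        intro y hy
        rw [hB, mem_filter]
        rcases mem_insert.mp hy with rfl | hyA
        · exact ⟨mem_univ _, rfl, hx0, le_rfl⟩
        · rw [hA, mem_filter] at hyA
          refine ⟨mem_univ _, hyA.2.1.trans hblk, hyA.2.2.1, ?_⟩
          have := hyA.2.2.2
          omega
      calc pathSum K u (K.parent x) + u (K.pbond x) ≤ (∑ y ∈ A, u (K.pbond y)) + u (K.pbond x) :=
            add_le_add (ih _ hp) le_rfl
        _ = ∑ y ∈ insert x A, u (K.pbond y) := by rw [sum_insert hxA, add_comm]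
        _ ≤ ∑ y ∈ Bset, u (K.pbond y) := sum_le_sum_of_subset_of_nonneg hsub fun y _ _ => hu _

/-- **The path sum is bounded by the block sum**: for u ≥ 0, pathSum u x ≤ Σ over all sites y of the block of x at
positive depth of u(parent bond of y). [folklore] -/
theorem pathSum_le_blockSum {u : Bd → ℝ} (hu : ∀ b, 0 ≤ u b) (x : St) :
    pathSum K u x ≤ ∑ y ∈ univ.filter (fun y => K.blk y = K.blk x ∧ K.depth y ≠ 0), u (K.pbond y) :=
  (pathSum_le_layerSum K hu x).trans
    (sum_le_sum_of_subset_of_nonneg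
      (fun y hy => by
        rw [mem_filter] at hy ⊢
        exact ⟨hy.1, hy.2.1, hy.2.2.1⟩)
      fun y _ _ => hu _)

end PathSum

/-! ## §2  The deviation of the transported field from its base-point value; the comb Poincaré step -/

section Deviation

variable {St Bd B Cp : Type} [Fintype Cp] [DecidableEq Cp] {src tgt : Bd → St} (K : Comb src tgt B)
  (c : Bd → ℝ) (Rm : Bd → Cp → Cp → ℝ)

/-- **Row isometry of the transport**: Σ_i (Σ_k (tr x)_{ik} v_k)² = Σ_k v_k² under the lineage binder hRm
(from `Comb.tr_orth`). [folklore] -/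
theorem sum_sq_tr_apply (hRm : ∀ b i j, ∑ k, Rm b k i * Rm b k j = if i = j then (1 : ℝ) else 0) (x : St)
    (v : Cp → ℝ) : ∑ i, (∑ k, K.tr Rm x i k * v k) ^ 2 = ∑ k, v k ^ 2 := by
  have horth := K.tr_orth Rm hRm x
  calc ∑ i, (∑ k, K.tr Rm x i k * v k) ^ 2
      = ∑ i, ∑ k, ∑ l, K.tr Rm x i k * v k * (K.tr Rm x i l * v l) := by
        refine Finset.sum_congr rfl fun i _ => ?_
        rw [sq, Finset.sum_mul_sum]
    _ = ∑ k, ∑ l, v k * v l * ∑ i, K.tr Rm x i k * K.tr Rm x i l := by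
        rw [Finset.sum_comm]
        refine Finset.sum_congr rfl fun k _ => ?_
        rw [Finset.sum_comm]
        refine Finset.sum_congr rfl fun l _ => ?_
        rw [Finset.mul_sum]
        exact Finset.sum_congr rfl fun i _ => by ring
    _ = ∑ k, ∑ l, v k * v l * (if k = l then (1 : ℝ) else 0) := by
        refine Finset.sum_congr rfl fun k _ => Finset.sum_congr rfl fun l _ => ?_
        rw [horth k l]
    _ = ∑ k, v k ^ 2 := by
        refine Finset.sum_congr rfl fun k _ => ?_
        rw [Finset.sum_eq_single k (fun l _ hl => by rw [if_neg (Ne.symm hl), mul_zero])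
          (fun h => absurd (mem_univ k) h)]
        simp [sq]

/-- **The deviation** dev(x)_i = ((tr x)f(x))_i − f(base of the block of x, i) of the transported field from its
base-point value (zero for a covariantly constant field, `Comb.tr_reproduces`). [folklore] -/
def dev (f : St × Cp → ℝ) (x : St) (i : Cp) : ℝ := (∑ j, K.tr Rm x i j * f (x, j)) - f (K.base (K.blk x), i)

/-- At a base point the deviation vanishes. [folklore] -/
theorem dev_of_depth_eq_zero (f : St × Cp → ℝ) {x : St} (hx : K.depth x = 0) (i : Cp) : dev K Rm f x i = 0 := by
  unfold dev
  simp_rw [K.tr_of_depth_eq_zero Rm hx]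
  rw [Finset.sum_eq_single i (fun j _ hj => by rw [if_neg (Ne.symm hj), zero_mul])
    (fun h => absurd (mem_univ i) h), if_pos rfl, one_mul, ← K.eq_base x hx, sub_self]

/-- **ONE STEP along the comb**: dev(x)_i − dev(parent x)_i = Σ_k (tr parent)_{ik}·c(b)⁻¹(∇_U f)(b, k) with b the
parent bond of x (c(b) ≠ 0) — the bond equation (∇_U f)(b) = c(b)(R(b)f(b₊) − f(b₋)) of (3.3) read along the comb.
[cite: Balaban1985BackgroundPropagators, (3.3) pp.390–391 + (3.19) p.393] -/
theorem dev_step (hc : ∀ b, c b ≠ 0) (f : St × Cp → ℝ) {x : St} (hx : K.depth x ≠ 0) (i : Cp) :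
    dev K Rm f x i - dev K Rm f (K.parent x) i =
      ∑ k, K.tr Rm (K.parent x) i k * ((c (K.pbond x))⁻¹ * covD src tgt c Rm f (K.pbond x, k)) := by
  have hcov : ∀ k, (c (K.pbond x))⁻¹ * covD src tgt c Rm f (K.pbond x, k) =
      ∑ j, Rm (K.pbond x) k j * f (x, j) - f (K.parent x, k) := by
    intro k
    rw [covD_apply, K.tgt_pbond x hx, K.src_pbond x hx, ← mul_assoc, inv_mul_cancel₀ (hc _), one_mul]
  simp_rw [hcov]
  unfold dev
  rw [K.blk_parent x hx]
  simp_rw [K.tr_of_depth_ne_zero Rm hx]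
  have e1 : ∑ j, (∑ k, K.tr Rm (K.parent x) i k * Rm (K.pbond x) k j) * f (x, j)
      = ∑ k, K.tr Rm (K.parent x) i k * ∑ j, Rm (K.pbond x) k j * f (x, j) := by
    simp_rw [Finset.sum_mul, Finset.mul_sum]
    rw [Finset.sum_comm]
    exact Finset.sum_congr rfl fun k _ => Finset.sum_congr rfl fun j _ => by ring
  rw [e1]
  simp_rw [mul_sub]
  rw [Finset.sum_sub_distrib]
  ring

/-- The built-in Cauchy–Schwarz step: m(α + β)² ≤ (m+1)α² + m(m+1)β² (all real m: the difference is (α − mβ)²). [folklore] -/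
theorem cs_step (m α β : ℝ) : m * (α + β) ^ 2 ≤ (m + 1) * α ^ 2 + m * (m + 1) * β ^ 2 := by
  nlinarith [sq_nonneg (α - m * β)]

/-- **THE COMB POINCARÉ INEQUALITY (pointwise)**: |dev(x)|² ≤ depth(x)·Σ_{path} c(b)⁻²|(∇_U f)(b)|² for isometric
bond matrices and non-zero bond weights. [folklore] -/
theorem dev_sq_le (hRm : ∀ b i j, ∑ k, Rm b k i * Rm b k j = if i = j then (1 : ℝ) else 0) (hc : ∀ b, c b ≠ 0)
    (f : St × Cp → ℝ) : ∀ x, ∑ i, dev K Rm f x i ^ 2 ≤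
      (K.depth x : ℝ) * pathSum K (fun b => (c b)⁻¹ ^ 2 * ∑ k, covD src tgt c Rm f (b, k) ^ 2) x := by
  set u : Bd → ℝ := fun b => (c b)⁻¹ ^ 2 * ∑ k, covD src tgt c Rm f (b, k) ^ 2 with hu_def
  have hu : ∀ b, 0 ≤ u b := fun b => mul_nonneg (sq_nonneg _) (Finset.sum_nonneg fun k _ => sq_nonneg _)
  suffices h : ∀ n x, K.depth x = n → ∑ i, dev K Rm f x i ^ 2 ≤ (K.depth x : ℝ) * pathSum K u x from
    fun x => h _ x rfl
  intro n
  induction n with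
  | zero =>
      intro x hx
      simp_rw [dev_of_depth_eq_zero K Rm f hx]
      rw [hx, pathSum_of_depth_eq_zero K u hx]
      simp
  | succ n ih =>
      intro x hx
      have hx0 : K.depth x ≠ 0 := by omega
      have hp : K.depth (K.parent x) = n := by
        have := K.depth_parent x hx0
        omega
      -- the increment β_i and its squared norm
      set β : Cp → ℝ := fun i =>
        ∑ k, K.tr Rm (K.parent x) i k * ((c (K.pbond x))⁻¹ * covD src tgt c Rm f (K.pbond x, k)) with hβ
      have hdev : ∀ i, dev K Rm f x i = dev K Rm f (K.parent x) i + β i := by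
        intro i
        have := dev_step K c Rm hc f hx0 i
        rw [hβ]
        linarith
      have hβsq : ∑ i, β i ^ 2 = u (K.pbond x) := by
        rw [hβ, sum_sq_tr_apply K Rm hRm (K.parent x)]
        rw [hu_def]
        simp only
        rw [Finset.mul_sum]
        exact Finset.sum_congr rfl fun k _ => by ring
      have hPS : pathSum K u x = pathSum K u (K.parent x) + u (K.pbond x) := pathSum_of_depth_ne_zero K u hx0
      have hm : (K.depth x : ℝ) = n + 1 := by exact_mod_cast hx
      rcases Nat.eq_zero_or_pos n with hn0 | hnpos
      · -- parent is a base point: dev(parent) = 0, pathSum(parent) = 0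
        subst hn0
        have hdp : ∀ i, dev K Rm f (K.parent x) i = 0 := fun i => dev_of_depth_eq_zero K Rm f hp i
        simp_rw [hdev, hdp, zero_add]
        rw [hβsq, hm, hPS, pathSum_of_depth_eq_zero K u hp]
        simp
      · have ihp := ih (K.parent x) hp
        rw [hp] at ihp
        have hnR : (1 : ℝ) ≤ n := by exact_mod_cast hnpos
        -- m Σ(α+β)² ≤ (m+1)Σα² + m(m+1)Σβ² ≤ (m+1)·m·P + m(m+1)u = m(m+1)(P + u)
        have hsum : (n : ℝ) * ∑ i, dev K Rm f x i ^ 2 ≤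
            (n + 1) * ∑ i, dev K Rm f (K.parent x) i ^ 2 + n * (n + 1) * ∑ i, β i ^ 2 := by
          rw [Finset.mul_sum, Finset.mul_sum, Finset.mul_sum, ← Finset.sum_add_distrib]
          exact Finset.sum_le_sum fun i _ => by rw [hdev i]; exact cs_step _ _ _
        rw [hβsq] at hsum
        have key : (n : ℝ) * ∑ i, dev K Rm f x i ^ 2 ≤ n * ((n + 1) * (pathSum K u (K.parent x) + u (K.pbond x))) := by
          nlinarith [mul_le_mul_of_nonneg_left ihp (by linarith : (0 : ℝ) ≤ n + 1), hu (K.pbond x),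
            pathSum_nonneg K hu (K.parent x)]
        rw [hm, hPS]
        exact le_of_mul_le_mul_left key (by exact_mod_cast hnpos)

end Deviation

/-! ## §3  The block identity and the coercivity of Δ_U + a·Q_UᵀQ_U, uniform in the transport -/

section Coercivity

/-- **The block identity** (one component): Σ_{x∈s} h(x)² ≤ (Σ_{x∈s} h(x))²/|s| + Σ_{x∈s} (h(x) − v)² for every
real v and every non-empty finite set s (equality iff v is the mean; the difference is (Σh − |s|v)²/|s|). [folklore] -/
theorem sum_sq_le_sq_sum_div_add {α : Type} (s : Finset α) (hs : s.Nonempty) (h : α → ℝ) (v : ℝ) :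
    ∑ x ∈ s, h x ^ 2 ≤ (∑ x ∈ s, h x) ^ 2 / s.card + ∑ x ∈ s, (h x - v) ^ 2 := by
  have hN : (0 : ℝ) < s.card := by exact_mod_cast hs.card_pos
  have hexp : ∑ x ∈ s, (h x - v) ^ 2 = ∑ x ∈ s, h x ^ 2 - 2 * v * ∑ x ∈ s, h x + s.card * v ^ 2 := by
    rw [Finset.mul_sum, ← Finset.sum_sub_distrib]
    rw [show (s.card : ℝ) * v ^ 2 = ∑ _x ∈ s, v ^ 2 by rw [Finset.sum_const, nsmul_eq_mul]]
    rw [← Finset.sum_add_distrib]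
    exact Finset.sum_congr rfl fun x _ => by ring
  rw [hexp]
  have key : 0 ≤ (∑ x ∈ s, h x - s.card * v) ^ 2 / s.card := div_nonneg (sq_nonneg _) hN.le
  have e : (∑ x ∈ s, h x - s.card * v) ^ 2 / s.card =
      (∑ x ∈ s, h x) ^ 2 / s.card - 2 * v * ∑ x ∈ s, h x + s.card * v ^ 2 := by
    field_simp
    ring
  linarith

variable {St Bd B Cp : Type} {src tgt : Bd → St} (K : Comb src tgt B) (c : Bd → ℝ) (w : B → ℝ)
  (Rm : Bd → Cp → Cp → ℝ)

/-- The ℓ² norm of a field is the ℓ² norm of the transported field (isometry at every site). [folklore] -/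
theorem sum_sq_eq_sum_sq_tr [Fintype St] [Fintype Cp] [DecidableEq Cp] (hRm : ∀ b i j, ∑ k, Rm b k i * Rm b k j = if i = j then (1 : ℝ) else 0)
    (f : St × Cp → ℝ) : ∑ p, f p ^ 2 = ∑ x, ∑ i, (∑ j, K.tr Rm x i j * f (x, j)) ^ 2 := by
  rw [Fintype.sum_prod_type]
  exact Finset.sum_congr rfl fun x _ => (sum_sq_tr_apply K Rm hRm x fun j => f (x, j)).symm

/-- The block sum of the transported field is the covariant mean divided by the block weight. [folklore] -/
theorem sum_filter_tr_eq [Fintype St] [DecidableEq B] [Fintype Cp] [DecidableEq Cp] (hw : ∀ β, w β ≠ 0) (f : St × Cp → ℝ) (β : B) (i : Cp) :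
    ∑ x ∈ univ.filter (fun x => K.blk x = β), ∑ j, K.tr Rm x i j * f (x, j) = (w β)⁻¹ * covMean K w Rm f (β, i) := by
  rw [covMean_apply, ← mul_assoc, inv_mul_cancel₀ (hw β), one_mul, Finset.sum_filter]

variable [Fintype St] [DecidableEq St] [Fintype Bd] [Fintype B] [DecidableEq B] [Fintype Cp] [DecidableEq Cp]

/-- **MAIN INEQUALITY (MODEL).** For isometric bond matrices, bond weights |c(b)| ≥ c_min > 0, block weights
|w(β)| ≥ w_min > 0, comb depth ≤ D and blocks of at most n sites:
Σ_p f(p)² ≤ w_min⁻²·Σ_q (Q_U f)(q)² + D·n·c_min⁻²·Σ_b ((∇_U f)(b))² for EVERY field f — uniform in the transport.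
[folklore] -/
theorem norm_sq_le (hRm : ∀ b i j, ∑ k, Rm b k i * Rm b k j = if i = j then (1 : ℝ) else 0)
    {cmin : ℝ} (hcmin : 0 < cmin) (hc : ∀ b, cmin ≤ |c b|) {wmin : ℝ} (hwmin : 0 < wmin) (hw : ∀ β, wmin ≤ |w β|)
    {D : ℕ} (hD : ∀ x, K.depth x ≤ D) {n : ℕ} (hn : ∀ β, (univ.filter fun x => K.blk x = β).card ≤ n)
    (f : St × Cp → ℝ) :
    ∑ p, f p ^ 2 ≤ (wmin ^ 2)⁻¹ * ∑ q, covMean K w Rm f q ^ 2 +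
      (D : ℝ) * n * (cmin ^ 2)⁻¹ * ∑ b, covD src tgt c Rm f b ^ 2 := by
  classical
  have hc0 : ∀ b, c b ≠ 0 := fun b h0 => by have := hc b; rw [h0, abs_zero] at this; linarith
  have hw0 : ∀ β, w β ≠ 0 := fun β h0 => by have := hw β; rw [h0, abs_zero] at this; linarith
  -- abbreviations
  set h : St → Cp → ℝ := fun x i => ∑ j, K.tr Rm x i j * f (x, j) with hh
  set u : Bd → ℝ := fun b => (c b)⁻¹ ^ 2 * ∑ k, covD src tgt c Rm f (b, k) ^ 2 with hu_def
  set g : Bd → ℝ := fun b => ∑ k, covD src tgt c Rm f (b, k) ^ 2 with hg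
  have hg0 : ∀ b, 0 ≤ g b := fun b => Finset.sum_nonneg fun k _ => sq_nonneg _
  have hu0 : ∀ b, 0 ≤ u b := fun b => mul_nonneg (sq_nonneg _) (hg0 b)
  have hug : ∀ b, u b ≤ (cmin ^ 2)⁻¹ * g b := by
    intro b
    refine mul_le_mul_of_nonneg_right ?_ (hg0 b)
    rw [inv_pow]
    exact inv_anti₀ (pow_pos hcmin 2) (pow_le_pow_left₀ hcmin.le ((hc b).trans (le_abs_self _ |>.trans_eq
      (abs_abs _))) 2 |>.trans_eq (sq_abs _))
  -- (1) per site: Σ_i dev² ≤ D · (cmin²)⁻¹ · Σ_{y in block, depth ≠ 0} g (pbond y)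
  have hdev : ∀ x, ∑ i, dev K Rm f x i ^ 2 ≤
      (D : ℝ) * ((cmin ^ 2)⁻¹ * ∑ y ∈ univ.filter (fun y => K.blk y = K.blk x ∧ K.depth y ≠ 0), g (K.pbond y)) := by
    intro x
    refine (dev_sq_le K c Rm hRm hc0 f x).trans ?_
    refine mul_le_mul (by exact_mod_cast hD x) ?_ (pathSum_nonneg K hu0 x) (Nat.cast_nonneg _)
    refine (pathSum_mono K hug x).trans ?_
    refine (pathSum_le_blockSum K (fun b => mul_nonneg (inv_nonneg.mpr (sq_nonneg _)) (hg0 b)) x).trans_eq ?_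
    rw [← Finset.mul_sum]
  -- (2) per block β and component i: the block identity with v = f(base β, i)
  have hblock : ∀ β i, ∑ x ∈ univ.filter (fun x => K.blk x = β), h x i ^ 2 ≤
      (wmin ^ 2)⁻¹ * covMean K w Rm f (β, i) ^ 2 + ∑ x ∈ univ.filter (fun x => K.blk x = β), dev K Rm f x i ^ 2 := by
    intro β i
    set s := univ.filter (fun x => K.blk x = β) with hs_def
    rcases s.eq_empty_or_nonempty with hs | hs
    · rw [hs]
      simp only [Finset.sum_empty, add_zero]
      exact mul_nonneg (inv_nonneg.mpr (sq_nonneg _)) (sq_nonneg _)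
    · have h1 := sum_sq_le_sq_sum_div_add s hs (fun x => h x i) (f (K.base β, i))
      have h2 : ∑ x ∈ s, (h x i - f (K.base β, i)) ^ 2 = ∑ x ∈ s, dev K Rm f x i ^ 2 := by
        refine Finset.sum_congr rfl fun x hx => ?_
        rw [hs_def, mem_filter] at hx
        unfold dev
        rw [hx.2]
      have h3 : (∑ x ∈ s, h x i) ^ 2 / s.card ≤ (wmin ^ 2)⁻¹ * covMean K w Rm f (β, i) ^ 2 := by
        have hS : ∑ x ∈ s, h x i = (w β)⁻¹ * covMean K w Rm f (β, i) := sum_filter_tr_eq K w Rm hw0 f β i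
        rw [hS, mul_pow, div_eq_mul_inv]
        have hcard : (1 : ℝ) ≤ s.card := by exact_mod_cast hs.card_pos
        have hwb : (w β)⁻¹ ^ 2 ≤ (wmin ^ 2)⁻¹ := by
          rw [inv_pow]
          exact inv_anti₀ (pow_pos hwmin 2) ((pow_le_pow_left₀ hwmin.le (hw β) 2).trans_eq (sq_abs _))
        calc (w β)⁻¹ ^ 2 * covMean K w Rm f (β, i) ^ 2 * (s.card : ℝ)⁻¹
            ≤ (w β)⁻¹ ^ 2 * covMean K w Rm f (β, i) ^ 2 * 1 :=
              mul_le_mul_of_nonneg_left (inv_le_one_of_one_le₀ hcard)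
                (mul_nonneg (sq_nonneg _) (sq_nonneg _))
          _ ≤ (wmin ^ 2)⁻¹ * covMean K w Rm f (β, i) ^ 2 := by
              rw [mul_one]
              exact mul_le_mul_of_nonneg_right hwb (sq_nonneg _)
      linarith
  -- (3) assemble over blocks and components
  have hsplit : ∑ p, f p ^ 2 = ∑ β, ∑ i, ∑ x ∈ univ.filter (fun x => K.blk x = β), h x i ^ 2 := by
    rw [sum_sq_eq_sum_sq_tr K Rm hRm f]
    rw [← Finset.sum_fiberwise_of_maps_to (s := univ) (t := univ) (g := K.blk) (fun x _ => mem_univ _)]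
    refine Finset.sum_congr rfl fun β _ => ?_
    rw [Finset.sum_comm]
  have hQ : ∑ q, covMean K w Rm f q ^ 2 = ∑ β, ∑ i, covMean K w Rm f (β, i) ^ 2 := Fintype.sum_prod_type _
  -- the gradient side: Σ_β Σ_i Σ_{x∈β} dev² = Σ_x Σ_i dev² ≤ Σ_x D (cmin²)⁻¹ Σ_{y ∈ blk x, depth≠0} g(pbond y)
  have hdevsum : ∑ β, ∑ i, ∑ x ∈ univ.filter (fun x => K.blk x = β), dev K Rm f x i ^ 2
      = ∑ x, ∑ i, dev K Rm f x i ^ 2 := by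
    rw [← Finset.sum_fiberwise_of_maps_to (s := univ) (t := univ) (g := K.blk) (fun x _ => mem_univ _)]
    refine Finset.sum_congr rfl fun β _ => ?_
    rw [Finset.sum_comm]
  -- Σ_{y ∈ blk x, depth ≠ 0} g (pbond y) ≤ Σ_{y ∈ blk x... } bounded by block: for each x, the inner sum ≤ T(blk x)
  -- where T β := Σ_{y: blk y = β ∧ depth y ≠ 0} g (pbond y); then Σ_x T(blk x) = Σ_β card(β) T β ≤ n Σ_β T β
  set T : B → ℝ := fun β => ∑ y ∈ univ.filter (fun y => K.blk y = β ∧ K.depth y ≠ 0), g (K.pbond y) with hT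
  have hT0 : ∀ β, 0 ≤ T β := fun β => Finset.sum_nonneg fun y _ => hg0 _
  have hTsum : ∑ x, T (K.blk x) = ∑ β, ((univ.filter fun x => K.blk x = β).card : ℝ) * T β := by
    rw [← Finset.sum_fiberwise_of_maps_to (s := univ) (t := univ) (g := K.blk) (fun x _ => mem_univ _)]
    refine Finset.sum_congr rfl fun β _ => ?_
    rw [Finset.sum_congr rfl fun x hx => show T (K.blk x) = T β by rw [(mem_filter.mp hx).2],
      Finset.sum_const, nsmul_eq_mul]
  have hTle : ∑ β, ((univ.filter fun x => K.blk x = β).card : ℝ) * T β ≤ n * ∑ β, T β := by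
    rw [Finset.mul_sum]
    exact Finset.sum_le_sum fun β _ => mul_le_mul_of_nonneg_right (by exact_mod_cast hn β) (hT0 β)
  -- Σ_β T β = Σ_{y : depth y ≠ 0} g (pbond y) ≤ Σ_b g b   (pbond injective on positive depth: tgt ∘ pbond = id)
  have hTtot : ∑ β, T β = ∑ y ∈ univ.filter (fun y => K.depth y ≠ 0), g (K.pbond y) := by
    rw [hT]
    rw [← Finset.sum_fiberwise_of_maps_to (s := univ.filter fun y => K.depth y ≠ 0) (t := univ) (g := K.blk)
      (fun y _ => mem_univ _)]
    refine Finset.sum_congr rfl fun β _ => Finset.sum_congr ?_ fun _ _ => rfl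
    ext y
    simp only [mem_filter, mem_univ, true_and]
    tauto
  have hinj : Set.InjOn K.pbond ↑(univ.filter fun y : St => K.depth y ≠ 0) := by
    intro y hy y' hy' hyy
    have h1 := K.tgt_pbond y (mem_filter.mp hy).2
    have h2 := K.tgt_pbond y' (mem_filter.mp hy').2
    rw [← h1, ← h2, hyy]
  have hpb : ∑ y ∈ univ.filter (fun y => K.depth y ≠ 0), g (K.pbond y) ≤ ∑ b, g b := by
    rw [← Finset.sum_image hinj]
    exact sum_le_sum_of_subset_of_nonneg (fun b _ => mem_univ b) fun b _ _ => hg0 b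
  have hG : ∑ b, g b = ∑ b, covD src tgt c Rm f b ^ 2 := by
    rw [Fintype.sum_prod_type]
  -- put everything together
  calc ∑ p, f p ^ 2 = ∑ β, ∑ i, ∑ x ∈ univ.filter (fun x => K.blk x = β), h x i ^ 2 := hsplit
    _ ≤ ∑ β, ∑ i, ((wmin ^ 2)⁻¹ * covMean K w Rm f (β, i) ^ 2 +
          ∑ x ∈ univ.filter (fun x => K.blk x = β), dev K Rm f x i ^ 2) :=
        Finset.sum_le_sum fun β _ => Finset.sum_le_sum fun i _ => hblock β i
    _ = (wmin ^ 2)⁻¹ * ∑ q, covMean K w Rm f q ^ 2 + ∑ x, ∑ i, dev K Rm f x i ^ 2 := by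
        rw [hQ, ← hdevsum, Finset.mul_sum]
        rw [← Finset.sum_add_distrib]
        refine Finset.sum_congr rfl fun β _ => ?_
        rw [Finset.mul_sum, ← Finset.sum_add_distrib]
    _ ≤ (wmin ^ 2)⁻¹ * ∑ q, covMean K w Rm f q ^ 2 + ∑ x, (D : ℝ) * ((cmin ^ 2)⁻¹ * T (K.blk x)) :=
        add_le_add le_rfl (Finset.sum_le_sum fun x _ => hdev x)
    _ = (wmin ^ 2)⁻¹ * ∑ q, covMean K w Rm f q ^ 2 + (D : ℝ) * (cmin ^ 2)⁻¹ * ∑ x, T (K.blk x) := by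
        congr 1
        rw [Finset.mul_sum]
        exact Finset.sum_congr rfl fun x _ => by ring
    _ ≤ (wmin ^ 2)⁻¹ * ∑ q, covMean K w Rm f q ^ 2 + (D : ℝ) * (cmin ^ 2)⁻¹ * (n * ∑ b, g b) := by
        have hDc : (0 : ℝ) ≤ (D : ℝ) * (cmin ^ 2)⁻¹ := mul_nonneg (Nat.cast_nonneg D) (inv_nonneg.mpr (sq_nonneg cmin))
        refine add_le_add le_rfl (mul_le_mul_of_nonneg_left ?_ hDc)
        rw [hTsum]
        exact hTle.trans (mul_le_mul_of_nonneg_left (hTtot.trans_le hpb) (Nat.cast_nonneg _))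
    _ = (wmin ^ 2)⁻¹ * ∑ q, covMean K w Rm f q ^ 2 +
          (D : ℝ) * n * (cmin ^ 2)⁻¹ * ∑ b, covD src tgt c Rm f b ^ 2 := by
        rw [hG]
        ring

/-- **The coercivity constant** σ = (1/(a·w_min²) + D·n/c_min²)⁻¹ of the one-step model (MODEL bookkeeping).
[folklore] -/
def sigma (a wmin cmin : ℝ) (D n : ℕ) : ℝ := ((a * wmin ^ 2)⁻¹ + (D : ℝ) * n * (cmin ^ 2)⁻¹)⁻¹

/-- σ > 0 for a, w_min > 0. [folklore] -/
theorem sigma_pos {a wmin : ℝ} (ha : 0 < a) (hwmin : 0 < wmin) (cmin : ℝ) (D n : ℕ) :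
    0 < sigma a wmin cmin D n := by
  unfold sigma
  refine inv_pos.mpr (add_pos_of_pos_of_nonneg (inv_pos.mpr (mul_pos ha (pow_pos hwmin 2))) ?_)
  exact mul_nonneg (mul_nonneg (Nat.cast_nonneg _) (Nat.cast_nonneg _)) (inv_nonneg.mpr (sq_nonneg _))

/-- **COERCIVITY OF Δ_U + a·Q_UᵀQ_U, UNIFORM IN THE TRANSPORT (MODEL of the positivity of Δ′_a, p. 395, with a
constant).** Under hRm, |c(b)| ≥ c_min > 0, |w(β)| ≥ w_min > 0, depth ≤ D, blocks of ≤ n sites and a > 0: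
σ·Σ_p f(p)² ≤ Σ_p f(p)((Δ_U + a·Q_UᵀQ_U)f)(p) for every f, σ = (1/(a·w_min²) + D·n/c_min²)⁻¹ — the same σ for
every transport. [cite: Balaban1985BackgroundPropagators, p.395 + (3.23)–(3.24) p.394 + (3.19) p.393] -/
theorem coercive_covLapCov (hRm : ∀ b i j, ∑ k, Rm b k i * Rm b k j = if i = j then (1 : ℝ) else 0)
    {cmin : ℝ} (hcmin : 0 < cmin) (hc : ∀ b, cmin ≤ |c b|) {wmin : ℝ} (hwmin : 0 < wmin) (hw : ∀ β, wmin ≤ |w β|)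
    {D : ℕ} (hD : ∀ x, K.depth x ≤ D) {n : ℕ} (hn : ∀ β, (univ.filter fun x => K.blk x = β).card ≤ n)
    {a : ℝ} (ha : 0 < a) (f : St × Cp → ℝ) :
    sigma a wmin cmin D n * ∑ p, f p ^ 2 ≤ ∑ p, f p * covLapCov K c w Rm a f p := by
  have hmain := norm_sq_le K c w Rm hRm hcmin hc hwmin hw hD hn f
  rw [qform_covLapCov]
  set X := ∑ q, covMean K w Rm f q ^ 2 with hX
  set Y := ∑ b, covD src tgt c Rm f b ^ 2 with hY
  have hX' : ∑ q, covMean K w Rm f q * covMean K w Rm f q = X := Finset.sum_congr rfl fun q _ => (sq _).symm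
  have hY' : ∑ b, covD src tgt c Rm f b * covD src tgt c Rm f b = Y := Finset.sum_congr rfl fun b _ => (sq _).symm
  rw [hX', hY']
  have hX0 : 0 ≤ X := Finset.sum_nonneg fun q _ => sq_nonneg _
  have hY0 : 0 ≤ Y := Finset.sum_nonneg fun b _ => sq_nonneg _
  set A := (a * wmin ^ 2)⁻¹ with hA
  set Bc := (D : ℝ) * n * (cmin ^ 2)⁻¹ with hBc
  have hA0 : 0 < A := inv_pos.mpr (mul_pos ha (pow_pos hwmin 2))
  have hB0 : 0 ≤ Bc := mul_nonneg (mul_nonneg (Nat.cast_nonneg _) (Nat.cast_nonneg _)) (inv_nonneg.mpr (sq_nonneg _))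
  have hσ : sigma a wmin cmin D n = (A + Bc)⁻¹ := rfl
  -- ‖f‖² ≤ (wmin²)⁻¹ X + Bc Y = A·(aX) + Bc·Y ≤ (A + Bc)(Y + aX)
  have h1 : ∑ p, f p ^ 2 ≤ (A + Bc) * (Y + a * X) := by
    have e : (wmin ^ 2)⁻¹ * X = A * (a * X) := by
      rw [hA, mul_inv, mul_comm a⁻¹, mul_assoc, inv_mul_cancel_left₀ ha.ne']
    calc ∑ p, f p ^ 2 ≤ (wmin ^ 2)⁻¹ * X + Bc * Y := hmain
      _ = A * (a * X) + Bc * Y := by rw [e]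
      _ ≤ (A + Bc) * (Y + a * X) := by nlinarith [mul_nonneg hA0.le hY0, mul_nonneg hB0 (mul_nonneg ha.le hX0)]
  rw [hσ]
  calc (A + Bc)⁻¹ * ∑ p, f p ^ 2 ≤ (A + Bc)⁻¹ * ((A + Bc) * (Y + a * X)) :=
        mul_le_mul_of_nonneg_left h1 (inv_nonneg.mpr (by linarith))
    _ = Y + a * X := by rw [← mul_assoc, inv_mul_cancel₀ (by linarith), one_mul]

/-- **ℓ² BOUND OF THE INVERSE, uniform in the transport**: Σ_p ((Δ_U + a·Q_UᵀQ_U)⁻¹g)(p)² ≤ σ⁻²·Σ_p g(p)² for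
every g (σ as in `coercive_covLapCov`; the inverse is `Ring.inverse`, a genuine two-sided inverse by
`B9Thm37GlueTorusCov.mul_inverse_covLapCov`). [folklore] -/
theorem inverse_sq_le (hRm : ∀ b i j, ∑ k, Rm b k i * Rm b k j = if i = j then (1 : ℝ) else 0)
    {cmin : ℝ} (hcmin : 0 < cmin) (hc : ∀ b, cmin ≤ |c b|) {wmin : ℝ} (hwmin : 0 < wmin) (hw : ∀ β, wmin ≤ |w β|)
    {D : ℕ} (hD : ∀ x, K.depth x ≤ D) {n : ℕ} (hn : ∀ β, (univ.filter fun x => K.blk x = β).card ≤ n)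
    {a : ℝ} (ha : 0 < a) (g : St × Cp → ℝ) :
    ∑ p, (Ring.inverse (covLapCov K c w Rm a) g) p ^ 2 ≤ (sigma a wmin cmin D n ^ 2)⁻¹ * ∑ p, g p ^ 2 := by
  have hc0 : ∀ b, c b ≠ 0 := fun b h0 => by have := hc b; rw [h0, abs_zero] at this; linarith
  have hw0 : ∀ β, w β ≠ 0 := fun β h0 => by have := hw β; rw [h0, abs_zero] at this; linarith
  set uu := Ring.inverse (covLapCov K c w Rm a) g with huu
  have hAu : covLapCov K c w Rm a uu = g := by
    have h := mul_inverse_covLapCov K c w Rm hRm hc0 hw0 ha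
    have := congrArg (fun T : Module.End ℝ (St × Cp → ℝ) => T g) h
    simpa [Module.End.mul_apply] using this
  have hσ := sigma_pos ha hwmin cmin D n
  set σ := sigma a wmin cmin D n with hσdef
  have hco := coercive_covLapCov K c w Rm hRm hcmin hc hwmin hw hD hn ha uu
  rw [hAu] at hco
  -- Cauchy–Schwarz: (Σ u g)² ≤ (Σ u²)(Σ g²)
  have hcs := Finset.sum_mul_sq_le_sq_mul_sq univ uu g
  set U2 := ∑ p, uu p ^ 2 with hU2
  set G2 := ∑ p, g p ^ 2 with hG2
  have hU0 : 0 ≤ U2 := Finset.sum_nonneg fun p _ => sq_nonneg _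
  have hG0 : 0 ≤ G2 := Finset.sum_nonneg fun p _ => sq_nonneg _
  -- σ U2 ≤ Σ u g  ⇒  σ² U2² ≤ (Σ u g)² ≤ U2 G2  ⇒  σ² U2 ≤ G2
  have h1 : σ * U2 ≤ ∑ p, uu p * g p := hco
  have h2 : (σ * U2) ^ 2 ≤ U2 * G2 :=
    (pow_le_pow_left₀ (mul_nonneg hσ.le hU0) h1 2).trans hcs
  have h3 : σ ^ 2 * U2 ≤ G2 := by
    rcases hU0.eq_or_lt with h0 | hpos
    · rw [← h0, mul_zero]; exact hG0
    · have : σ ^ 2 * U2 * U2 ≤ G2 * U2 := by nlinarith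
      exact le_of_mul_le_mul_right this hpos
  calc U2 = (σ ^ 2)⁻¹ * (σ ^ 2 * U2) := by rw [← mul_assoc, inv_mul_cancel₀ (pow_pos hσ 2).ne', one_mul]
    _ ≤ (σ ^ 2)⁻¹ * G2 := mul_le_mul_of_nonneg_left h3 (inv_nonneg.mpr (sq_nonneg _))

end Coercivity

/-! ## §4  The torus: depth ≤ d(M₀ − 1), blocks of M₀^d sites, the uniform constant σ(d, M₀, c_min, w_min, a) -/

section Torus

variable {d : ℕ} {N : Fin d → ℕ}

/-- Every offset is < M₀ (1 ≤ M₀). [folklore] -/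
theorem offs_lt {M₀ : ℕ} (hM : 1 ≤ M₀) (x : UT N) (μ : Fin d) : offs M₀ x μ < M₀ := Nat.mod_lt _ hM

/-- **The comb depth on the torus is at most d(M₀ − 1).** [folklore] -/
theorem tdepth_le {M₀ : ℕ} (hM : 1 ≤ M₀) (x : UT N) : tdepth M₀ x ≤ d * (M₀ - 1) := by
  unfold tdepth
  calc ∑ μ, offs M₀ x μ ≤ ∑ _μ : Fin d, (M₀ - 1) := Finset.sum_le_sum fun μ _ => by
          have := offs_lt hM x μ; omega
    _ = d * (M₀ - 1) := by rw [Finset.sum_const, Finset.card_univ, Fintype.card_fin, smul_eq_mul]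

variable [∀ i, NeZero (N i)]

/-- A torus point is determined by its block label and its offsets. [folklore] -/
theorem eq_of_tblk_eq_of_offs_eq {M₀ : ℕ} (hM : 1 ≤ M₀) (hdiv : ∀ i, M₀ ∣ N i) {x y : UT N}
    (hb : tblk hM hdiv x = tblk hM hdiv y) (ho : ∀ μ, offs M₀ x μ = offs M₀ y μ) : x = y := by
  have h : ∀ μ, UT.toSite N x μ = UT.toSite N y μ := by
    intro μ
    apply Fin.ext
    have h1 := Nat.div_add_mod (UT.toSite N x μ).val M₀
    have h2 := Nat.div_add_mod (UT.toSite N y μ).val M₀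
    have hq : (UT.toSite N x μ).val / M₀ = (UT.toSite N y μ).val / M₀ := by
      have := congrArg (fun z : Ctr N M₀ => (z μ).val) hb
      simpa [tblk_val] using this
    have hr : (UT.toSite N x μ).val % M₀ = (UT.toSite N y μ).val % M₀ := ho μ
    rw [hq, hr] at h1
    omega
  exact funext h

/-- **A block of the torus comb has at most M₀^d sites** (injection x ↦ (x_μ mod M₀)_μ into (Fin M₀)^d).
[folklore] -/
theorem card_block_le {M₀ : ℕ} (hM : 1 ≤ M₀) (hdiv : ∀ i, M₀ ∣ N i) (z : Ctr N M₀) :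
    (univ.filter fun x : UT N => tblk hM hdiv x = z).card ≤ M₀ ^ d := by
  have hcard : (univ : Finset (Fin d → Fin M₀)).card = M₀ ^ d := by
    rw [Finset.card_univ, Fintype.card_pi, Finset.prod_const, Fintype.card_fin, Finset.card_univ, Fintype.card_fin]
  rw [← hcard]
  refine Finset.card_le_card_of_injOn (fun x μ => ⟨offs M₀ x μ, offs_lt hM x μ⟩) (fun x _ => mem_univ _) ?_
  intro x hx y hy hxy
  have hbx := (mem_filter.mp hx).2
  have hby := (mem_filter.mp hy).2
  refine eq_of_tblk_eq_of_offs_eq hM hdiv (hbx.trans hby.symm) fun μ => ?_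
  have := congrFun hxy μ
  simpa using congrArg Fin.val this

variable [NeZero d]

/-- **The coercivity constant of the torus model**: σ(d, M₀, c_min, w_min, a) = (1/(a·w_min²) +
d(M₀−1)M₀^d/c_min²)⁻¹ — independent of the torus and of the transport (MODEL bookkeeping). [folklore] -/
def sigmaTorus (d M₀ : ℕ) (a wmin cmin : ℝ) : ℝ := sigma a wmin cmin (d * (M₀ - 1)) (M₀ ^ d)

/-- σ(d, M₀, c_min, w_min, a) > 0 (a, w_min > 0). [folklore] -/
theorem sigmaTorus_pos (d M₀ : ℕ) {a wmin : ℝ} (ha : 0 < a) (hwmin : 0 < wmin) (cmin : ℝ) :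
    0 < sigmaTorus d M₀ a wmin cmin := sigma_pos ha hwmin cmin _ _

/-- **COERCIVITY ON THE TORUS, UNIFORM IN THE VOLUME AND IN THE TRANSPORT.** For every torus `UT N` with 1 ≤ M₀,
M₀ ∣ N_i, every isometric transport (hRm), bond weights |c(b)| ≥ c_min > 0, block weights |w(z)| ≥ w_min > 0 and
a > 0: σ(d, M₀, c_min, w_min, a)·Σ_p f(p)² ≤ Σ_p f(p)((Δ_U + a·Q_UᵀQ_U)f)(p) for every field f. [cite: Balaban1985BackgroundPropagators, p.395 + (3.23)–(3.24) p.394 + (3.19) p.393] -/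
theorem coercive_covLapCov_torus {Cp : Type} [Fintype Cp] [DecidableEq Cp] {M₀ : ℕ} (hM : 1 ≤ M₀)
    (hdiv : ∀ i, M₀ ∣ N i) (c : UT N × Fin d → ℝ) {cmin : ℝ} (hcmin : 0 < cmin) (hc : ∀ b, cmin ≤ |c b|)
    (w : Ctr N M₀ → ℝ) {wmin : ℝ} (hwmin : 0 < wmin) (hw : ∀ z, wmin ≤ |w z|)
    (Rm : UT N × Fin d → Cp → Cp → ℝ) (hRm : ∀ b i j, ∑ k, Rm b k i * Rm b k j = if i = j then (1 : ℝ) else 0)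
    {a : ℝ} (ha : 0 < a) (f : UT N × Cp → ℝ) :
    sigmaTorus d M₀ a wmin cmin * ∑ p, f p ^ 2 ≤ ∑ p, f p * covLapCov (torusComb hM hdiv) c w Rm a f p :=
  coercive_covLapCov (torusComb hM hdiv) c w Rm hRm hcmin hc hwmin hw (fun x => tdepth_le hM x)
    (fun z => card_block_le hM hdiv z) ha f

/-- **ℓ² BOUND OF (Δ_U + a·Q_UᵀQ_U)⁻¹ ON THE TORUS, uniform in the volume and in the transport**:
Σ_p ((Δ_U + a·Q_UᵀQ_U)⁻¹g)(p)² ≤ σ(d, M₀, c_min, w_min, a)⁻²·Σ_p g(p)². [folklore] -/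
theorem inverse_sq_le_torus {Cp : Type} [Fintype Cp] [DecidableEq Cp] {M₀ : ℕ} (hM : 1 ≤ M₀)
    (hdiv : ∀ i, M₀ ∣ N i) (c : UT N × Fin d → ℝ) {cmin : ℝ} (hcmin : 0 < cmin) (hc : ∀ b, cmin ≤ |c b|)
    (w : Ctr N M₀ → ℝ) {wmin : ℝ} (hwmin : 0 < wmin) (hw : ∀ z, wmin ≤ |w z|)
    (Rm : UT N × Fin d → Cp → Cp → ℝ) (hRm : ∀ b i j, ∑ k, Rm b k i * Rm b k j = if i = j then (1 : ℝ) else 0)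
    {a : ℝ} (ha : 0 < a) (g : UT N × Cp → ℝ) :
    ∑ p, (Ring.inverse (covLapCov (torusComb hM hdiv) c w Rm a) g) p ^ 2 ≤
      (sigmaTorus d M₀ a wmin cmin ^ 2)⁻¹ * ∑ p, g p ^ 2 :=
  inverse_sq_le (torusComb hM hdiv) c w Rm hRm hcmin hc hwmin hw (fun x => tdepth_le hM x)
    (fun z => card_block_le hM hdiv z) ha g

end Torus

end

end Literature.MathematicalPhysics.QuantumFieldTheory.Balaban1983to89.B9Thm37GlueTorusCovPoinc
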